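import Literature.Probability.Percolation.ArmSeparationInRouteFour
import Literature.Probability.Percolation.ArmSeparationInLandingFour
import Literature.Probability.Percolation.ArmSeparationIntSurgeryFour
import Literature.Probability.Percolation.ArmSeparationOutCoverFour
import HarnessLib

/-!
# The inner landing bound for four alternating arms: covering `IntTinyExt4` by routed slots

Topic `Literature/Probability/Percolation`; family `crit-perc` / near-critical percolation on `𝕋`.
A brick of the near-critical arm-separation theorem for four arms of alternating colours
(P. Nolin, *Near-critical percolation in two dimensions*, EJP 13 (2008), Thm. 11 for `j = 4`,
`σ = BWBW` [arXiv 0711.4948: Thm. 10], landing step of the INTERNAL extremities, §4.4 p. 13 with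
Prop. 12 (i) and Lemma 13): the inner twin of `ArmSeparationOutCoverFour.lean`. Every configuration
of `IntTinyExt4 m N k₀ K R₀` (four fenced inner tips with their outer landings and the anticlockwise
order certificate, `ArmSeparationIntSurgeryFour.lean`) lies in the arm event of a routed inner slot
in range (`exists_islot_of_mem`): the tip data are good (`ITipData.Good`, the row gaps by
`int_row_gap_of_lt₂`, the same-colour clause by the order certificate read linearly,
`frame_eq_and_row_sbtw_int`), the order certificate on `∂Λ_m` is transported to the key circle of the
fictitious half-radius `Mstar` (`frKey_lt_iff_hexPos_lt`, `cyc_lt_cyc_iff_of_iso₂`), and the routing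
certificate of `ArmSeparationInRouteFour.lean` gives the slot. Summing Nolin's Lemma 13 over the slots
(`real_biUnion_arms_le_in`) gives the landing inequality at the parameter `p`
(`real_intTinyExt4_le_at`):
`P_p(IntTinyExt4) · (c_F c^{B+3})⁴ ≤ 2 (∏_q inSlot4Bound P q ^ 4) · (P_p(sepFourArmG n N 0) + P_p(sepFourArmG n N 3))`.
Everything here is proved; no named facts are introduced.

## References

* P. Nolin, Near-critical percolation in two dimensions, *Electron. J. Probab.* 13 (2008), §4.3
  Prop. 12 (i), Lemma 13, §4.4 (arXiv 0711.4948: Prop. 11, Lemma 12; proof of Thm. 10, p. 13) [Nolin2008].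
* H. Kesten, Scaling relations for 2D-percolation, *Comm. Math. Phys.* 109 (1987), Lemmas 4–6 [Kesten1987].
-/

noncomputable section

open Set MeasureTheory

namespace Literature.Probability.Percolation

open LatticeModels Lanes

/-! ### Keys and perimeter coordinates -/

/-- **The key order is the perimeter order.** For framed points of the open right side of `∂Λ_K` with
rows in `(-2M, 0) ∩ (-K, 0)`, the keys `frKey M` compare as the perimeter coordinates `hexPos K`. [folklore] -/
theorem frKey_lt_iff_hexPos_lt {M K i i' : ℕ} (hi : i < 6) (hi' : i' < 6) {y y' : ℤ} (hy : -(2 * (M : ℤ)) < y)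
    (hyK : -(K : ℤ) < y) (hy0 : y < 0) (hy' : -(2 * (M : ℤ)) < y') (hyK' : -(K : ℤ) < y') (hy0' : y' < 0) :
    frKey M i y < frKey M i' y' ↔ hexPos K (frameIso i ![(K : ℤ), y]) < hexPos K (frameIso i' ![(K : ℤ), y']) := by
  obtain ⟨a0, a1, a2, a3, a4, a5⟩ := hexPos_frameIso_side0 hyK hy0
  obtain ⟨b0, b1, b2, b3, b4, b5⟩ := hexPos_frameIso_side0 hyK' hy0'
  interval_cases i <;> interval_cases i' <;>
    simp only [frKey_zero, frKey_one, frKey_two, frKey_three, frKey_four, frKey_five, a0, a1, a2, a3, a4, a5,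
      b0, b1, b2, b3, b4, b5] <;> omega

/-- **Cyclic comparisons are preserved by strictly monotone correspondences** (two moduli). [folklore] -/
theorem cyc_lt_cyc_iff_of_iso₂ {P P' o a b o' a' b' : ℤ} (ha : 0 ≤ a ∧ a < P) (hb : 0 ≤ b ∧ b < P)
    (ha' : 0 ≤ a' ∧ a' < P') (hb' : 0 ≤ b' ∧ b' < P')
    (h2 : a < o ↔ a' < o') (h4 : b < o ↔ b' < o') (h5 : a < b ↔ a' < b') (h6 : b < a ↔ b' < a') :
    (cyc P o a < cyc P o b ↔ cyc P' o' a' < cyc P' o' b') := by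
  unfold cyc; split_ifs <;> omega

/-- **The perimeter coordinate of a framed point of the open right side is affine in the row**, with
slope `±1`, and lies in the block `(iK, (i+1)K)` of its frame. [folklore] -/
theorem hexPos_frameIso_side0_affine (K : ℕ) {i : ℕ} (hi : i < 6) :
    ∃ ε o : ℤ, (ε = 1 ∨ ε = -1) ∧ ∀ y : ℤ, -(K : ℤ) < y → y < 0 →
      hexPos K (frameIso i ![(K : ℤ), y]) = o + ε * y ∧ (i : ℤ) * K < hexPos K (frameIso i ![(K : ℤ), y]) ∧
        hexPos K (frameIso i ![(K : ℤ), y]) < ((i : ℤ) + 1) * K := by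
  have main : ∀ y : ℤ, -(K : ℤ) < y → y < 0 →
      hexPos K (frameIso 0 ![(K : ℤ), y]) = K + 1 * y ∧ hexPos K (frameIso 1 ![(K : ℤ), y]) = 2 * K + 1 * y ∧
      hexPos K (frameIso 2 ![(K : ℤ), y]) = 2 * K + (-1) * y ∧ hexPos K (frameIso 3 ![(K : ℤ), y]) = 4 * K + 1 * y ∧
      hexPos K (frameIso 4 ![(K : ℤ), y]) = 5 * K + 1 * y ∧ hexPos K (frameIso 5 ![(K : ℤ), y]) = 5 * K + (-1) * y := by
    intro y hy hy0
    obtain ⟨a0, a1, a2, a3, a4, a5⟩ := hexPos_frameIso_side0 hy hy0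
    refine ⟨?_, ?_, ?_, ?_, ?_, ?_⟩ <;> linarith
  interval_cases i
  · exact ⟨1, K, Or.inl rfl, fun y hy hy0 => by have h := (main y hy hy0).1; refine ⟨h, ?_, ?_⟩ <;> rw [h] <;> push_cast <;> linarith⟩
  · exact ⟨1, 2 * K, Or.inl rfl, fun y hy hy0 => by have h := (main y hy hy0).2.1; refine ⟨h, ?_, ?_⟩ <;> rw [h] <;> push_cast <;> linarith⟩
  · exact ⟨-1, 2 * K, Or.inr rfl, fun y hy hy0 => by have h := (main y hy hy0).2.2.1; refine ⟨h, ?_, ?_⟩ <;> rw [h] <;> push_cast <;> linarith⟩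
  · exact ⟨1, 4 * K, Or.inl rfl, fun y hy hy0 => by have h := (main y hy hy0).2.2.2.1; refine ⟨h, ?_, ?_⟩ <;> rw [h] <;> push_cast <;> linarith⟩
  · exact ⟨1, 5 * K, Or.inl rfl, fun y hy hy0 => by have h := (main y hy hy0).2.2.2.2.1; refine ⟨h, ?_, ?_⟩ <;> rw [h] <;> push_cast <;> linarith⟩
  · exact ⟨-1, 5 * K, Or.inr rfl, fun y hy hy0 => by have h := (main y hy hy0).2.2.2.2.2; refine ⟨h, ?_, ?_⟩ <;> rw [h] <;> push_cast <;> linarith⟩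

/-- **Linear betweenness on a common frame, inner tips**: if the perimeter coordinate of the framed
tip `(i', zb)` lies strictly between those of `(i, za)` and `(i, zc)` (middle tips of the right side of
`Λ_m`), then `i' = i` and the row of `zb` lies strictly between the rows of `za, zc`. [folklore] -/
theorem frame_eq_and_row_sbtw_int {m R₀ : ℕ} (hR₀ : 1 ≤ R₀) {za zb zc : Site 2} {i i' : ℕ} (hi : i < 6) (hi' : i' < 6)
    (hza : za 0 = m) (hzb : zb 0 = m) (hzc : zc 0 = m)
    (ga : IntMidTip m R₀ za) (gb : IntMidTip m R₀ zb) (gc : IntMidTip m R₀ zc)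
    (h : SBtw (hexPos m (frameIso i za)) (hexPos m (frameIso i' zb)) (hexPos m (frameIso i zc))) :
    i' = i ∧ SBtw (za 1) (zb 1) (zc 1) := by
  obtain ⟨ga1, ga2⟩ := ga; obtain ⟨gb1, gb2⟩ := gb; obtain ⟨gc1, gc2⟩ := gc
  rw [site_eq_vec2 hza rfl, site_eq_vec2 hzb rfl, site_eq_vec2 hzc rfl] at h
  obtain ⟨ε, o, hε, f⟩ := hexPos_frameIso_side0_affine m hi
  obtain ⟨ε', o', -, f'⟩ := hexPos_frameIso_side0_affine m hi'
  obtain ⟨ea, la, ua⟩ := f (za 1) (by omega) (by omega)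
  obtain ⟨-, lb, ub⟩ := f' (zb 1) (by omega) (by omega)
  obtain ⟨ec, lc, uc⟩ := f (zc 1) (by omega) (by omega)
  have hK : (0 : ℤ) < (m : ℤ) := by omega
  have hii : i' = i := by
    have hbtw : (i : ℤ) * m < hexPos m (frameIso i' ![(m : ℤ), zb 1]) ∧ hexPos m (frameIso i' ![(m : ℤ), zb 1]) < ((i : ℤ) + 1) * m := by
      unfold SBtw at h; constructor <;> rcases h with ⟨h1, h2⟩ | ⟨h1, h2⟩ <;> linarith
    have h1 : (i : ℤ) < i' + 1 := lt_of_mul_lt_mul_right (hbtw.1.trans ub) hK.le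
    have h2 : (i' : ℤ) < i + 1 := lt_of_mul_lt_mul_right (lb.trans hbtw.2) hK.le
    omega
  subst hii
  obtain ⟨eb, -, -⟩ := f (zb 1) (by omega) (by omega)
  refine ⟨rfl, ?_⟩
  rw [ea, eb, ec] at h
  unfold SBtw at h ⊢
  rcases hε with rfl | rfl <;> omega

/-- `frameIso 0` is the identity on sets. [folklore] -/
theorem image_frameIso_zero (S : Set (Site 2)) : (frameIso 0 : triGraph ≃g triGraph) '' S = S := by
  ext v
  exact ⟨by rintro ⟨w, hw, rfl⟩; exact hw, fun hv => ⟨v, hv, rfl⟩⟩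

/-! ### The slots cover `IntTinyExt4` -/

namespace ITipData

variable {P : LParams} {D : ITipData} {tc : Fin 4 → ℕ} {R : TipData.Route}

/-- The tips are read by a rotation. [folklore] -/
theorem route_tip_eq_add (R : TipData.Route) (e : Fin 4) : R.tip e = R.tip 0 + e := by
  simp only [TipData.Route.tip, TipData.Route.q, zero_sub]; abel

/-- **The landing sides of the routed slot** are the landing sides of the routed tips. [folklore] -/
theorem os_slot (hR : ITipData.RouteGood P D tc R) (e : Fin 4) : (slot P D tc R).os e = Slot4.ts (R.tip e) := by
  have hpar0 := hR.tip_parity 0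
  have hlt := (R.tip 0).isLt
  have h02 : R.tip 0 = 0 ∨ R.tip 0 = 2 := by
    rcases (show ((R.tip 0 : Fin 4) : ℕ) = 0 ∨ ((R.tip 0 : Fin 4) : ℕ) = 2 by simp only [Fin.val_zero] at hpar0; omega) with h | h
    · exact Or.inl (Fin.ext h)
    · exact Or.inr (Fin.ext h)
  show (if decide (R.tip 0 = 2) = true then (Slot4.ts e + 3) % 6 else Slot4.ts e) = Slot4.ts (R.tip e)
  rw [route_tip_eq_add R e]
  rcases h02 with h | h
  · rw [h, zero_add, show decide ((0 : Fin 4) = 2) = false from rfl]; simp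
  · rw [h, show decide ((2 : Fin 4) = 2) = true from rfl, if_pos rfl]
    fin_cases e <;> rfl

end ITipData

/-- **Every configuration of `IntTinyExt4` lies in the arm event of a routed inner slot in range.** [cite: Nolin2008, §4.4 p. 13 with §4.3 Prop. 12 (i) (arXiv 0711.4948: proof of Thm. 10; Prop. 11)] -/
theorem exists_islot_of_mem {P : LParams} (hV : P.RValid) {ω : SiteConfig (Site 2)} (hω : ω ∈ IntTinyExt4 P.m P.N P.k₀ P.K P.R₀) :
    ∃ σ ∈ inSlot4Finset P, σ.InRange P ∧ InSlot4.RouteOK P σ ∧ ω ∈ ⋂ e, σ.armE P e := by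
  obtain ⟨z, u, hz, o0, o1, o2, o3, i, hi, F₀, F₁, F₂, F₃, b0, b1, b2, b3, c23, c30⟩ := hω
  obtain ⟨hs, hk₀, hμ, hw1, hw2, -, -, -, -, hM1, hM2, hr1, hr2, hr3, -, hm, hN, hn, hR16, hμM, hR₀, hR₀M, -, -⟩ := hV.rfacts
  have hw : 1 ≤ P.w := by have : (1 : ℤ) ≤ P.w := by omega
                          exact_mod_cast this
  have hm1 : 1 ≤ P.m := by have : (1 : ℤ) ≤ P.m := by omega
                           exact_mod_cast this
  have hR₀1 : 1 ≤ P.R₀ := by have : (1 : ℤ) ≤ P.R₀ := by omega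
                             exact_mod_cast this
  have hN2 : 2 * P.m ≤ P.N := by have : 2 * (P.m : ℤ) ≤ P.N := hN
                                 exact_mod_cast this
  have hKm : ∀ j < P.K, 64 * trapScale P.k₀ j < P.m := fun j hj => by
    have h1 : 32 * (trapScale P.k₀ j : ℤ) ≤ P.μ := by exact_mod_cast P.scale_le hj
    have : 64 * (trapScale P.k₀ j : ℤ) < P.m := by omega
    exact_mod_cast this
  -- the tips
  have z0 := F₀.z_isIntJ.1; have z1 := F₁.z_isIntJ.1; have z2 := F₂.z_isIntJ.1; have z3 := F₃.z_isIntJ.1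
  obtain ⟨g0a, g0b⟩ := F₀.z_mid; obtain ⟨g1a, g1b⟩ := F₁.z_mid; obtain ⟨g2a, g2b⟩ := F₂.z_mid; obtain ⟨g3a, g3b⟩ := F₃.z_mid
  have n0 : triNorm (frameIso (i 0) F₀.z) = P.m := by rw [triNorm_frameIso _ (hi 0)]; exact triNorm_of_isIntJ F₀.z_isIntJ
  have n1 : triNorm (frameIso (i 1) F₁.z) = P.m := by rw [triNorm_frameIso _ (hi 1)]; exact triNorm_of_isIntJ F₁.z_isIntJ
  have n2 : triNorm (frameIso (i 2) F₂.z) = P.m := by rw [triNorm_frameIso _ (hi 2)]; exact triNorm_of_isIntJ F₂.z_isIntJ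
  have n3 : triNorm (frameIso (i 3) F₃.z) = P.m := by rw [triNorm_frameIso _ (hi 3)]; exact triNorm_of_isIntJ F₃.z_isIntJ
  -- windows
  obtain ⟨ν₀, hν₀, t0a, t0b⟩ := exists_window P hw (t := F₀.z 1) (by omega) (by omega)
  obtain ⟨ν₁, hν₁, t1a, t1b⟩ := exists_window P hw (t := F₁.z 1) (by omega) (by omega)
  obtain ⟨ν₂, hν₂, t2a, t2b⟩ := exists_window P hw (t := F₂.z 1) (by omega) (by omega)
  obtain ⟨ν₃, hν₃, t3a, t3b⟩ := exists_window P hw (t := F₃.z 1) (by omega) (by omega)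
  -- the tip data
  set D : ITipData := ⟨i, ![F₀.j, F₁.j, F₂.j, F₃.j], ![ν₀, ν₁, ν₂, ν₃], ![F₀.z 1, F₁.z 1, F₂.z 1, F₃.z 1]⟩ with hD
  -- norms of the regions
  have hregS : ∀ (ii s : ℕ), ii < 6 → s < 6 → ∀ a, ∀ v ∈ ((frameIso ii).symm : triGraph ≃g triGraph) '' ((frameIso s : triGraph ≃g triGraph) '' armRegion P.m P.N (z a)),
      (P.m : ℤ) ≤ triNorm v := by
    intro ii s hii hss a v hv
    obtain ⟨w, hw, rfl⟩ := hv
    have h1 := (norm_mem_frame_armRegion hss hN2 (hz a) w hw).1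
    rw [← triNorm_frameIso ii hii (((frameIso ii).symm : triGraph ≃g triGraph) w), RelIso.apply_symm_apply]
    exact h1
  have hreg0 : ∀ v ∈ ((frameIso (i 0)).symm : triGraph ≃g triGraph) '' armRegion P.m P.N (z 0), (P.m : ℤ) ≤ triNorm v := by
    intro v hv
    obtain ⟨w, hw, rfl⟩ := hv
    have h1 := (norm_mem_frame_armRegion (s := 0) (by norm_num) hN2 (hz 0) (frameIso 0 w) ⟨w, hw, rfl⟩).1
    rw [← triNorm_frameIso (i 0) (hi 0) (((frameIso (i 0)).symm : triGraph ≃g triGraph) w), RelIso.apply_symm_apply]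
    exact h1
  -- row gaps of tips of different colours on a common frame
  have m0 := F₀.z_mem_config; have m1 := F₁.z_mem_config; have m2 := F₂.z_mem_config; have m3 := F₃.z_mem_config
  have g01 : i 0 = i 1 → F₀.z 1 + 8 * F₀.k < F₁.z 1 ∨ F₁.z 1 + 8 * F₁.k < F₀.z 1 := fun h => by
    have hne : F₀.z 1 ≠ F₁.z 1 := fun heq => by
      have ez : F₀.z = F₁.z := by rw [site_eq_vec2 z0 rfl, site_eq_vec2 z1 rfl, heq]
      have h0 := mem_frameConfig.1 m0
      rw [ez, h] at h0
      exact m1 (mem_frameConfig.2 h0)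
    have hcol : ∀ v, v ∈ (frameConfig (i 1) ω)ᶜ → v ∉ frameConfig (i 0) ω := fun v hv hv' => by rw [h] at hv'; exact hv hv'
    have hcol' : ∀ v, v ∈ frameConfig (i 0) ω → v ∉ (frameConfig (i 1) ω)ᶜ := fun v hv hv' => by rw [h] at hv; exact hv' hv
    rcases lt_or_gt_of_ne hne with hlt | hlt
    · exact Or.inl (int_row_gap_of_lt₂ (hregS _ _ (hi 1) (by norm_num) 1) hKm hcol F₀ F₁ hlt)
    · exact Or.inr (int_row_gap_of_lt₂ hreg0 hKm hcol' F₁ F₀ hlt)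
  have g03 : i 0 = i 3 → F₀.z 1 + 8 * F₀.k < F₃.z 1 ∨ F₃.z 1 + 8 * F₃.k < F₀.z 1 := fun h => by
    have hne : F₀.z 1 ≠ F₃.z 1 := fun heq => by
      have ez : F₀.z = F₃.z := by rw [site_eq_vec2 z0 rfl, site_eq_vec2 z3 rfl, heq]
      have h0 := mem_frameConfig.1 m0
      rw [ez, h] at h0
      exact m3 (mem_frameConfig.2 h0)
    have hcol : ∀ v, v ∈ (frameConfig (i 3) ω)ᶜ → v ∉ frameConfig (i 0) ω := fun v hv hv' => by rw [h] at hv'; exact hv hv'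
    have hcol' : ∀ v, v ∈ frameConfig (i 0) ω → v ∉ (frameConfig (i 3) ω)ᶜ := fun v hv hv' => by rw [h] at hv; exact hv' hv
    rcases lt_or_gt_of_ne hne with hlt | hlt
    · exact Or.inl (int_row_gap_of_lt₂ (hregS _ _ (hi 3) (by norm_num) 3) hKm hcol F₀ F₃ hlt)
    · exact Or.inr (int_row_gap_of_lt₂ hreg0 hKm hcol' F₃ F₀ hlt)
  have g21 : i 2 = i 1 → F₂.z 1 + 8 * F₂.k < F₁.z 1 ∨ F₁.z 1 + 8 * F₁.k < F₂.z 1 := fun h => by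
    have hne : F₂.z 1 ≠ F₁.z 1 := fun heq => by
      have ez : F₂.z = F₁.z := by rw [site_eq_vec2 z2 rfl, site_eq_vec2 z1 rfl, heq]
      have h0 := mem_frameConfig.1 m2
      rw [ez, h] at h0
      exact m1 (mem_frameConfig.2 h0)
    have hcol : ∀ v, v ∈ (frameConfig (i 1) ω)ᶜ → v ∉ frameConfig (i 2) ω := fun v hv hv' => by rw [h] at hv'; exact hv hv'
    have hcol' : ∀ v, v ∈ frameConfig (i 2) ω → v ∉ (frameConfig (i 1) ω)ᶜ := fun v hv hv' => by rw [h] at hv; exact hv' hv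
    rcases lt_or_gt_of_ne hne with hlt | hlt
    · exact Or.inl (int_row_gap_of_lt₂ (hregS _ _ (hi 1) (by norm_num) 1) hKm hcol F₂ F₁ hlt)
    · exact Or.inr (int_row_gap_of_lt₂ (hregS _ _ (hi 2) (by norm_num) 2) hKm hcol' F₁ F₂ hlt)
  have g23 : i 2 = i 3 → F₂.z 1 + 8 * F₂.k < F₃.z 1 ∨ F₃.z 1 + 8 * F₃.k < F₂.z 1 := fun h => by
    have hne : F₂.z 1 ≠ F₃.z 1 := fun heq => by
      have ez : F₂.z = F₃.z := by rw [site_eq_vec2 z2 rfl, site_eq_vec2 z3 rfl, heq]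
      have h0 := mem_frameConfig.1 m2
      rw [ez, h] at h0
      exact m3 (mem_frameConfig.2 h0)
    have hcol : ∀ v, v ∈ (frameConfig (i 3) ω)ᶜ → v ∉ frameConfig (i 2) ω := fun v hv hv' => by rw [h] at hv'; exact hv hv'
    have hcol' : ∀ v, v ∈ frameConfig (i 2) ω → v ∉ (frameConfig (i 3) ω)ᶜ := fun v hv hv' => by rw [h] at hv; exact hv' hv
    rcases lt_or_gt_of_ne hne with hlt | hlt
    · exact Or.inl (int_row_gap_of_lt₂ (hregS _ _ (hi 3) (by norm_num) 3) hKm hcol F₂ F₃ hlt)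
    · exact Or.inr (int_row_gap_of_lt₂ (hregS _ _ (hi 2) (by norm_num) 2) hKm hcol' F₃ F₂ hlt)
  -- the certificate, linearly
  have h12 : frameIso (i 1) F₁.z ≠ frameIso (i 2) F₂.z := fun heq => by
    apply m1; rw [mem_frameConfig, heq]; exact mem_frameConfig.1 m2
  have hP6 : (6 * (P.m : ℤ)) = 6 * (P.m : ℤ) := rfl
  have r0 := hexPos_range hm1 n0; have r1 := hexPos_range hm1 n1
  have r2 := hexPos_range hm1 n2; have r3 := hexPos_range hm1 n3
  have hp12 : hexPos P.m (frameIso (i 1) F₁.z) ≠ hexPos P.m (frameIso (i 2) F₂.z) := fun heq => h12 (hexPos_injOn hm1 n1 n2 heq)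
  have s11 : hexShift P.m (frameIso (i 1) F₁.z) (frameIso (i 1) F₁.z) = 0 := by rw [hexShift_eq_cyc, Lanes.cyc_self]
  have s12 : 0 < hexShift P.m (frameIso (i 1) F₁.z) (frameIso (i 2) F₂.z) := by
    rw [hexShift_eq_cyc]; unfold cyc; split_ifs <;> omega
  obtain ⟨sb1, sb2⟩ := sbtw_of_hexShift_lt hm1 n1 n1 n2 n3 n0 (by rw [s11]; exact s12) c23 c30
  have hGood : D.Good P :=
    { hi := hi
      hj := by intro a; fin_cases a <;> [exact F₀.j_lt; exact F₁.j_lt; exact F₂.j_lt; exact F₃.j_lt]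
      hν := by intro a; fin_cases a <;> [exact hν₀; exact hν₁; exact hν₂; exact hν₃]
      hζ := by intro a; fin_cases a <;> [exact ⟨t0a, t0b⟩; exact ⟨t1a, t1b⟩; exact ⟨t2a, t2b⟩; exact ⟨t3a, t3b⟩]
      hgood := by intro a; fin_cases a <;> [exact ⟨g0a, g0b⟩; exact ⟨g1a, g1b⟩; exact ⟨g2a, g2b⟩; exact ⟨g3a, g3b⟩]
      hdiff := by
        intro a b hpar hab
        fin_cases a <;> fin_cases b <;>
          first
            | exact (hpar (by decide)).elim
            | exact g01 hab | exact (g01 hab.symm).symm | exact g03 hab | exact (g03 hab.symm).symm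
            | exact g21 hab | exact (g21 hab.symm).symm | exact g23 hab | exact (g23 hab.symm).symm
      hsame02 := by
        intro h02
        change i 0 = i 2 at h02
        have e2 : hexPos P.m (frameIso (i 2) F₂.z) = hexPos P.m (frameIso (i 0) F₂.z) :=
          (congrArg (fun x => hexPos P.m (frameIso x F₂.z)) h02).symm
        have e0 : hexPos P.m (frameIso (i 0) F₀.z) = hexPos P.m (frameIso (i 2) F₀.z) :=
          congrArg (fun x => hexPos P.m (frameIso x F₀.z)) h02
        rcases sb2 with h | h
        · have h' := h.symm'
          rw [e2] at h'
          obtain ⟨hc, hsb⟩ := frame_eq_and_row_sbtw_int hR₀1 (hi 0) (hi 1) z0 z1 z2 ⟨g0a, g0b⟩ ⟨g1a, g1b⟩ ⟨g2a, g2b⟩ h'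
          exact ⟨1, by decide, hc, hsb⟩
        · rw [e0] at h
          obtain ⟨hc, hsb⟩ := frame_eq_and_row_sbtw_int hR₀1 (hi 2) (hi 3) z2 z3 z0 ⟨g2a, g2b⟩ ⟨g3a, g3b⟩ ⟨g0a, g0b⟩ h
          exact ⟨3, by decide, hc.trans h02.symm, hsb.symm'⟩
      hsame13 := by
        intro h13
        change i 1 = i 3 at h13
        have e3 : hexPos P.m (frameIso (i 3) F₃.z) = hexPos P.m (frameIso (i 1) F₃.z) :=
          (congrArg (fun x => hexPos P.m (frameIso x F₃.z)) h13).symm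
        rcases sb1 with h | h
        · rw [e3] at h
          obtain ⟨hc, hsb⟩ := frame_eq_and_row_sbtw_int hR₀1 (hi 1) (hi 2) z1 z2 z3 ⟨g1a, g1b⟩ ⟨g2a, g2b⟩ ⟨g3a, g3b⟩ h
          exact ⟨2, by decide, hc, hsb⟩
        · rw [e3] at h
          obtain ⟨hc, hsb⟩ := frame_eq_and_row_sbtw_int hR₀1 (hi 1) (hi 0) z1 z0 z3 ⟨g1a, g1b⟩ ⟨g0a, g0b⟩ ⟨g3a, g3b⟩ h
          exact ⟨0, by decide, hc, hsb⟩ }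
  -- targets and the routing certificate
  obtain ⟨tc, htc, htgt⟩ := ITipData.exists_tgt (P := P) D
  -- keys versus perimeter coordinates
  obtain ⟨-, -, -, -, -, -, -, -, -, y0a, y0b⟩ := hGood.facts hV 0
  obtain ⟨-, -, -, -, -, -, -, -, -, y1a, y1b⟩ := hGood.facts hV 1
  obtain ⟨-, -, -, -, -, -, -, -, -, y2a, y2b⟩ := hGood.facts hV 2
  obtain ⟨-, -, -, -, -, -, -, -, -, y3a, y3b⟩ := hGood.facts hV 3
  change -(2 * (P.Mstar : ℤ)) < F₀.z 1 at y0a; change F₀.z 1 < 0 at y0b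
  change -(2 * (P.Mstar : ℤ)) < F₁.z 1 at y1a; change F₁.z 1 < 0 at y1b
  change -(2 * (P.Mstar : ℤ)) < F₂.z 1 at y2a; change F₂.z 1 < 0 at y2b
  change -(2 * (P.Mstar : ℤ)) < F₃.z 1 at y3a; change F₃.z 1 < 0 at y3b
  have k0 := hGood.κz_range hV 0; have k1 := hGood.κz_range hV 1; have k2 := hGood.κz_range hV 2; have k3 := hGood.κz_range hV 3
  change 0 ≤ frKey P.Mstar (i 0) (F₀.z 1) ∧ frKey P.Mstar (i 0) (F₀.z 1) < 12 * P.Mstar at k0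
  change 0 ≤ frKey P.Mstar (i 1) (F₁.z 1) ∧ frKey P.Mstar (i 1) (F₁.z 1) < 12 * P.Mstar at k1
  change 0 ≤ frKey P.Mstar (i 2) (F₂.z 1) ∧ frKey P.Mstar (i 2) (F₂.z 1) < 12 * P.Mstar at k2
  change 0 ≤ frKey P.Mstar (i 3) (F₃.z 1) ∧ frKey P.Mstar (i 3) (F₃.z 1) < 12 * P.Mstar at k3
  -- the comparison lemma for two tips
  have L : ∀ {ia ib : ℕ}, ia < 6 → ib < 6 → ∀ {za zb : Site 2}, za 0 = P.m → zb 0 = P.m →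
      -(2 * (P.Mstar : ℤ)) < za 1 → za 1 < 0 → -(P.m : ℤ) < za 1 → -(2 * (P.Mstar : ℤ)) < zb 1 → zb 1 < 0 → -(P.m : ℤ) < zb 1 →
      (hexPos P.m (frameIso ia za) < hexPos P.m (frameIso ib zb) ↔ frKey P.Mstar ia (za 1) < frKey P.Mstar ib (zb 1)) := by
    intro ia ib hia hib za zb hza hzb ya1 ya2 ya3 yb1 yb2 yb3
    conv_lhs => rw [site_eq_vec2 hza rfl, site_eq_vec2 hzb rfl]
    exact (frKey_lt_iff_hexPos_lt hia hib ya1 ya3 ya2 yb1 yb3 yb2).symm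
  have m0' : -(P.m : ℤ) < F₀.z 1 := by omega
  have m1' : -(P.m : ℤ) < F₁.z 1 := by omega
  have m2' : -(P.m : ℤ) < F₂.z 1 := by omega
  have m3' : -(P.m : ℤ) < F₃.z 1 := by omega
  have L10 := L (hi 1) (hi 0) z1 z0 y1a y1b m1' y0a y0b m0'
  have L01 := L (hi 0) (hi 1) z0 z1 y0a y0b m0' y1a y1b m1'
  have L12 := L (hi 1) (hi 2) z1 z2 y1a y1b m1' y2a y2b m2'
  have L21 := L (hi 2) (hi 1) z2 z1 y2a y2b m2' y1a y1b m1'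
  have L13 := L (hi 1) (hi 3) z1 z3 y1a y1b m1' y3a y3b m3'
  have L31 := L (hi 3) (hi 1) z3 z1 y3a y3b m3' y1a y1b m1'
  have L23 := L (hi 2) (hi 3) z2 z3 y2a y2b m2' y3a y3b m3'
  have L32 := L (hi 3) (hi 2) z3 z2 y3a y3b m3' y2a y2b m2'
  have L30 := L (hi 3) (hi 0) z3 z0 y3a y3b m3' y0a y0b m0'
  have L03 := L (hi 0) (hi 3) z0 z3 y0a y0b m0' y3a y3b m3'
  rw [hexShift_eq_cyc, hexShift_eq_cyc] at c23 c30
  have r0' : 0 ≤ hexPos P.m (frameIso (i 0) F₀.z) ∧ hexPos P.m (frameIso (i 0) F₀.z) < 6 * (P.m : ℤ) := ⟨r0.1, by linarith [r0.2]⟩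
  have r1' : 0 ≤ hexPos P.m (frameIso (i 1) F₁.z) ∧ hexPos P.m (frameIso (i 1) F₁.z) < 6 * (P.m : ℤ) := ⟨r1.1, by linarith [r1.2]⟩
  have r2' : 0 ≤ hexPos P.m (frameIso (i 2) F₂.z) ∧ hexPos P.m (frameIso (i 2) F₂.z) < 6 * (P.m : ℤ) := ⟨r2.1, by linarith [r2.2]⟩
  have r3' : 0 ≤ hexPos P.m (frameIso (i 3) F₃.z) ∧ hexPos P.m (frameIso (i 3) F₃.z) < 6 * (P.m : ℤ) := ⟨r3.1, by linarith [r3.2]⟩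
  have c2' := (cyc_lt_cyc_iff_of_iso₂ r2' r3' k2 k3 L21 L31 L23 L32).1 c23
  have c3' := (cyc_lt_cyc_iff_of_iso₂ r3' r0' k3 k0 L31 L01 L30 L03).1 c30
  have hk12 : frKey P.Mstar (i 1) (F₁.z 1) < frKey P.Mstar (i 2) (F₂.z 1) ∨ frKey P.Mstar (i 2) (F₂.z 1) < frKey P.Mstar (i 1) (F₁.z 1) := by
    rcases lt_or_gt_of_ne hp12 with h | h
    · exact Or.inl (L12.1 h)
    · exact Or.inr (L21.1 h)
  have c1' : cyc (12 * (P.Mstar : ℤ)) (frKey P.Mstar (i 1) (F₁.z 1)) (frKey P.Mstar (i 1) (F₁.z 1)) <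
      cyc (12 * (P.Mstar : ℤ)) (frKey P.Mstar (i 1) (F₁.z 1)) (frKey P.Mstar (i 2) (F₂.z 1)) := by
    rw [Lanes.cyc_self]; unfold cyc; split_ifs <;> omega
  obtain ⟨R, hR⟩ := ITipData.exists_route hV hGood htc htgt ⟨D.κz P 1, k1.1, k1.2, c1', c2', c3'⟩
  refine ⟨ITipData.slot P D tc R, ITipData.slot_mem_inSlot4Finset hV hGood htc,
    ⟨fun e => hGood.hi (R.tip e), fun e => hGood.hj (R.tip e), htc, fun e => laneLevel_lt _ _ _⟩,
    ITipData.routeOK_slot hV hGood htc htgt hR, ?_⟩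
  -- the arms
  have hA0 : ((frameIso (i 0)).symm : triGraph ≃g triGraph) '' armRegion P.m P.N (z 0) =
      ((frameIso (i 0)).symm : triGraph ≃g triGraph) '' ((frameIso 0 : triGraph ≃g triGraph) '' armRegion P.m P.N (z 0)) := by
    rw [image_frameIso_zero]
  have harm0 : ∃ zz uu : Site 2, zz ∈ sepLanding P.N ∧
      OpenVCrossThrough (sepOuterFence P.N zz) (zz 1 - (P.N / 64 : ℕ)) (zz 1 + (P.N / 64 : ℕ))
        (frameConfig (Slot4.ts 0) (colCfg (decide (((0 : Fin 4) : ℕ) % 2 = 0)) ω)) uu ∧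
      ∃ F : IntFencedArm P.m ((frameIso (D.i 0)).symm '' (frameIso (Slot4.ts 0) '' armRegion P.m P.N zz)) P.k₀ P.K P.R₀
        (frameConfig (D.i 0) (colCfg (decide (((0 : Fin 4) : ℕ) % 2 = 0)) ω)),
        F.j = D.j 0 ∧ D.T P 0 ≤ F.z 1 ∧ F.z 1 < D.T P 0 + P.w ∧ F.b = (frameIso (D.i 0)).symm (frameIso (Slot4.ts 0) uu) := by
    rw [show Slot4.ts (0 : Fin 4) = 0 from rfl, show decide (((0 : Fin 4) : ℕ) % 2 = 0) = true from rfl, colCfg_true, frameConfig_zero]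
    exact ⟨z 0, u 0, hz 0, o0, F₀.cast hA0 rfl, rfl, t0a, t0b, b0⟩
  have harm1 : ∃ zz uu : Site 2, zz ∈ sepLanding P.N ∧
      OpenVCrossThrough (sepOuterFence P.N zz) (zz 1 - (P.N / 64 : ℕ)) (zz 1 + (P.N / 64 : ℕ))
        (frameConfig (Slot4.ts 1) (colCfg (decide (((1 : Fin 4) : ℕ) % 2 = 0)) ω)) uu ∧
      ∃ F : IntFencedArm P.m ((frameIso (D.i 1)).symm '' (frameIso (Slot4.ts 1) '' armRegion P.m P.N zz)) P.k₀ P.K P.R₀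
        (frameConfig (D.i 1) (colCfg (decide (((1 : Fin 4) : ℕ) % 2 = 0)) ω)),
        F.j = D.j 1 ∧ D.T P 1 ≤ F.z 1 ∧ F.z 1 < D.T P 1 + P.w ∧ F.b = (frameIso (D.i 1)).symm (frameIso (Slot4.ts 1) uu) := by
    rw [show Slot4.ts (1 : Fin 4) = 2 from rfl, show decide (((1 : Fin 4) : ℕ) % 2 = 0) = false from rfl, colCfg_false,
      ← frameConfig_compl (D.i 1) ω]
    exact ⟨z 1, u 1, hz 1, o1, F₁, rfl, t1a, t1b, b1⟩
  have harm2 : ∃ zz uu : Site 2, zz ∈ sepLanding P.N ∧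
      OpenVCrossThrough (sepOuterFence P.N zz) (zz 1 - (P.N / 64 : ℕ)) (zz 1 + (P.N / 64 : ℕ))
        (frameConfig (Slot4.ts 2) (colCfg (decide (((2 : Fin 4) : ℕ) % 2 = 0)) ω)) uu ∧
      ∃ F : IntFencedArm P.m ((frameIso (D.i 2)).symm '' (frameIso (Slot4.ts 2) '' armRegion P.m P.N zz)) P.k₀ P.K P.R₀
        (frameConfig (D.i 2) (colCfg (decide (((2 : Fin 4) : ℕ) % 2 = 0)) ω)),
        F.j = D.j 2 ∧ D.T P 2 ≤ F.z 1 ∧ F.z 1 < D.T P 2 + P.w ∧ F.b = (frameIso (D.i 2)).symm (frameIso (Slot4.ts 2) uu) := by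
    rw [show Slot4.ts (2 : Fin 4) = 3 from rfl, show decide (((2 : Fin 4) : ℕ) % 2 = 0) = true from rfl, colCfg_true]
    exact ⟨z 2, u 2, hz 2, o2, F₂, rfl, t2a, t2b, b2⟩
  have harm3 : ∃ zz uu : Site 2, zz ∈ sepLanding P.N ∧
      OpenVCrossThrough (sepOuterFence P.N zz) (zz 1 - (P.N / 64 : ℕ)) (zz 1 + (P.N / 64 : ℕ))
        (frameConfig (Slot4.ts 3) (colCfg (decide (((3 : Fin 4) : ℕ) % 2 = 0)) ω)) uu ∧
      ∃ F : IntFencedArm P.m ((frameIso (D.i 3)).symm '' (frameIso (Slot4.ts 3) '' armRegion P.m P.N zz)) P.k₀ P.K P.R₀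
        (frameConfig (D.i 3) (colCfg (decide (((3 : Fin 4) : ℕ) % 2 = 0)) ω)),
        F.j = D.j 3 ∧ D.T P 3 ≤ F.z 1 ∧ F.z 1 < D.T P 3 + P.w ∧ F.b = (frameIso (D.i 3)).symm (frameIso (Slot4.ts 3) uu) := by
    rw [show Slot4.ts (3 : Fin 4) = 5 from rfl, show decide (((3 : Fin 4) : ℕ) % 2 = 0) = false from rfl, colCfg_false,
      ← frameConfig_compl (D.i 3) ω]
    exact ⟨z 3, u 3, hz 3, o3, F₃, rfl, t3a, t3b, b3⟩
  have harm : ∀ a : Fin 4, ∃ zz uu : Site 2, zz ∈ sepLanding P.N ∧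
      OpenVCrossThrough (sepOuterFence P.N zz) (zz 1 - (P.N / 64 : ℕ)) (zz 1 + (P.N / 64 : ℕ))
        (frameConfig (Slot4.ts a) (colCfg (decide ((a : ℕ) % 2 = 0)) ω)) uu ∧
      ∃ F : IntFencedArm P.m ((frameIso (D.i a)).symm '' (frameIso (Slot4.ts a) '' armRegion P.m P.N zz)) P.k₀ P.K P.R₀
        (frameConfig (D.i a) (colCfg (decide ((a : ℕ) % 2 = 0)) ω)),
        F.j = D.j a ∧ D.T P a ≤ F.z 1 ∧ F.z 1 < D.T P a + P.w ∧ F.b = (frameIso (D.i a)).symm (frameIso (Slot4.ts a) uu) := by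
    intro a
    fin_cases a <;> assumption
  have hos := fun e => ITipData.os_slot hR e
  rw [Set.mem_iInter]
  intro e
  have hc : Slot4.col e = decide (((R.tip e : Fin 4) : ℕ) % 2 = 0) := by unfold Slot4.col; rw [hR.tip_parity]
  show ∃ zz uu : Site 2, zz ∈ sepLanding P.N ∧
      OpenVCrossThrough (sepOuterFence P.N zz) (zz 1 - (P.N / 64 : ℕ)) (zz 1 + (P.N / 64 : ℕ))
        (frameConfig ((ITipData.slot P D tc R).os e) (colCfg (Slot4.col e) ω)) uu ∧
      ∃ F : IntFencedArm P.m ((frameIso (D.i (R.tip e))).symm '' (frameIso ((ITipData.slot P D tc R).os e) '' armRegion P.m P.N zz))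
        P.k₀ P.K P.R₀ (frameConfig (D.i (R.tip e)) (colCfg (Slot4.col e) ω)),
        F.j = D.j (R.tip e) ∧ D.T P (R.tip e) ≤ F.z 1 ∧ F.z 1 < D.T P (R.tip e) + P.w ∧
          F.b = (frameIso (D.i (R.tip e))).symm (frameIso ((ITipData.slot P D tc R).os e) uu)
  rw [hos e, hc]
  exact harm (R.tip e)

/-! ### The landing inequality at `p` -/

/-- **The inner landing bound at `p` for `IntTinyExt4`.** For a valid rung `P` (`K ≥ 1`,
`R₀ ≥ 16 μ`), a parameter `p` with the frame-continuation input `hF` and the RSW input `hrsw` (aspect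
ratio `ρ ≥ 128`, sizes up to `Ncap`) at `p` and at `1 - p`:
`P_p(IntTinyExt4 m N k₀ K R₀) · (c_F c^{B+3})⁴ ≤ 2 (∏_q inSlot4Bound P q ^ 4) · (P_p(sepFourArmG n N 0) + P_p(sepFourArmG n N 3))`
(`iLL 7 + μ ≤ 2ρε`, `n/8 ≤ Ncap`, `iGr 0 ≤ B`). [cite: Nolin2008, §4.4 p. 13 with §4.3 Prop. 12 (i), Lemma 13 (arXiv 0711.4948: proof of Thm. 10; Prop. 11, Lemma 12)] -/
theorem real_intTinyExt4_le_at {P : LParams} (hV : P.RValid) (p : unitInterval) {cF c : ℝ} {ρ Ncap B : ℕ}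
    (hF : ∀ q : unitInterval, (q = p ∨ q = unitInterval.symm p) →
      ∀ (z : Site 2) (k : ℕ), 1 ≤ k → k ≤ Ncap → cF ≤ (triSitePercolation q).real (triFrameAt z k))
    (hrsw : ∀ q : unitInterval, (q = p ∨ q = unitInterval.symm p) →
      ∀ n : ℕ, 1 ≤ ⌊(ρ : ℝ) * n⌋₊ → n ≤ Ncap → c ≤ triLRCrossingProb q ⌊(ρ : ℝ) * n⌋₊ n)
    (hρ : 128 ≤ ρ) (hc : 0 ≤ c) (hcF : 0 ≤ cF) (hsp : P.iLL 7 + P.μ ≤ ρ * (2 * P.ε)) (hcap : P.n / 8 ≤ Ncap) (hB : P.iGr 0 ≤ B) :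
    (triSitePercolation p).real (IntTinyExt4 P.m P.N P.k₀ P.K P.R₀) * (cF * c ^ (B + 3)) ^ 4 ≤
      (((∏ q : Fin 7, inSlot4Bound P q ^ 4) * 2 : ℕ) : ℝ) *
        ((triSitePercolation p).real (sepFourArmG P.n P.N 0) + (triSitePercolation p).real (sepFourArmG P.n P.N 3)) := by
  classical
  set S := (inSlot4Finset P).filter (fun σ => σ.InRange P ∧ InSlot4.RouteOK P σ) with hS
  have hsub : IntTinyExt4 P.m P.N P.k₀ P.K P.R₀ ⊆ ⋃ σ ∈ S, ⋂ e, σ.armE P e := fun ω hω => by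
    obtain ⟨σ, hσ, hin, hro, hmem⟩ := exists_islot_of_mem hV hω
    exact Set.mem_iUnion₂.2 ⟨σ, Finset.mem_filter.2 ⟨hσ, hin, hro⟩, hmem⟩
  have hS' : ∀ σ ∈ S, σ.InRange P ∧ InSlot4.RouteOK P σ := fun σ hσ => (Finset.mem_filter.1 hσ).2
  have h1 := real_biUnion_arms_le_in hV.toValid hV.hK hV.hR16 p hF hrsw hρ hc hcF hsp hcap hB S hS'
  have hcard : (S.card : ℝ) ≤ (((∏ q : Fin 7, inSlot4Bound P q ^ 4) * 2 : ℕ) : ℝ) := by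
    exact_mod_cast (Finset.card_filter_le _ _).trans (card_inSlot4Finset P).le
  have hq0 : 0 ≤ (cF * c ^ (B + 3)) ^ 4 := by positivity
  have hE0 : 0 ≤ (triSitePercolation p).real (sepFourArmG P.n P.N 0) + (triSitePercolation p).real (sepFourArmG P.n P.N 3) := by
    positivity
  calc (triSitePercolation p).real (IntTinyExt4 P.m P.N P.k₀ P.K P.R₀) * (cF * c ^ (B + 3)) ^ 4
      ≤ (triSitePercolation p).real (⋃ σ ∈ S, ⋂ e, σ.armE P e) * (cF * c ^ (B + 3)) ^ 4 :=
        mul_le_mul_of_nonneg_right (measureReal_mono hsub (measure_ne_top _ _)) hq0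
    _ ≤ S.card * ((triSitePercolation p).real (sepFourArmG P.n P.N 0) + (triSitePercolation p).real (sepFourArmG P.n P.N 3)) := h1
    _ ≤ _ := mul_le_mul_of_nonneg_right hcard hE0

end Literature.Probability.Percolation

end
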